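import Mathlib
import Summits.Ventures.PercRepro2.A3PendantFree

/-!
# (FM) is leaf-closed: `FMfun(v) = q · FMfun(x)` for `v` a leaf at `x`
(blind cell PercRepro2, night-1 g31; proofs/NIGHT1-G31.md §3″)

Let `v` be a leaf attached to `x` by the edge `g` of weight `q = p g`, `p₁ = p[g ↦ 1]`.  The `v`-fibres
transfer to the `x`-fibres under the open pin (A3PendantFreeFibres.lean with the roles `a₃ := v`,
`v := x`), the centring `γ₀ = m_o / P(Q)` is the same on both sides (free events), and the first-order
`PD`-part is linear in the `A`-sums — so the first-order functional propagates along the leaf EXACTLY: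

  **`FMfun p o a₁ a₂ v b = q · FMfun p₁ o a₁ a₂ x b`**   (`FMfun_leaf`, for `P(Q) ≠ 0`)

(the `(1 − q)`-terms of the `{v}`-fibre cancel identically — there is no `btw`-type mixing at first order,
in contrast with `btw_leaf_free`).  Hence (FM) at a pendant vertex is (FM) at its attachment point
(`FM_leaf_iff` for `q > 0`): along a pendant path (FM) reduces to the root of the path, and the open
content of (FM) sits at vertices of degree `≥ 2`.  Standard axioms.
-/

namespace Summit.Ventures.PercRepro2

open UnionCluster CovForm PendantRoot PendantO

namespace CovForm

namespace A3Fibre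

section LeafClosed

variable {V : Type*} {E : Type*} [Fintype V] [DecidableEq V] [Fintype E] [DecidableEq E]
  {R : Type*} [Field R] [LinearOrder R] [IsStrictOrderedRing R]
  {ends : E → Sym2 V} {g : E} {v x : V}

omit [Fintype V] [LinearOrder R] [IsStrictOrderedRing R] in
/-- `SFg(v, γ, W) = q · SFg(x at p₁, γ, W)` for `x ∈ W`, any centring `γ`. -/
lemma SFg_leaf_of_mem (p : E → R) (hg : ends g = s(v, x)) (hleaf : ∀ e, v ∈ ends e → e = g)
    (hvx : v ≠ x) (o a₁ a₂ : V) (γ : R) {W : Finset V} (hxW : x ∈ W) :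
    RootEdge.SFg p ends o a₁ a₂ v γ W =
      p g * RootEdge.SFg (Function.update p g 1) ends o a₁ a₂ x γ W := by
  unfold RootEdge.SFg
  rw [Ssig_leaf_of_mem p hg hleaf hvx a₁ a₂ o hxW, Su_leaf_of_mem p hg hleaf hvx a₁ a₂ o hxW,
    mW_leaf_of_mem p hg hleaf hvx a₁ a₂ hxW]
  ring

omit [Fintype V] in
/-- The pointwise leaf split of the ratio term at a fixed centring `γ`. -/
lemma termg_leaf_split {p : E → R} (hp : IsProbVec p) (hg : ends g = s(v, x))
    (hleaf : ∀ e, v ∈ ends e → e = g) (hvx : v ≠ x) (o a₁ a₂ b : V) (γ : R) (W : Finset V) :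
    Ssig p ends a₁ a₂ v b W * RootEdge.SFg p ends o a₁ a₂ v γ W / mW p ends a₁ a₂ v W =
      (if W = {v} then
        Ssig p ends a₁ a₂ v b {v} * RootEdge.SFg p ends o a₁ a₂ v γ {v} / mW p ends a₁ a₂ v {v} else 0) +
      p g * (Ssig (Function.update p g 1) ends a₁ a₂ x b W *
        RootEdge.SFg (Function.update p g 1) ends o a₁ a₂ x γ W /
        mW (Function.update p g 1) ends a₁ a₂ x W) := by
  by_cases hW : W = {v}
  · subst hW
    rw [if_pos rfl, Ssig_eq_zero_of_notMem_self _ ends a₁ a₂ x b (notMem_singleton_of_ne hvx),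
      zero_mul, zero_div, mul_zero, add_zero]
  · rw [if_neg hW, zero_add]
    by_cases hx : x ∈ W
    · rw [Ssig_leaf_of_mem p hg hleaf hvx a₁ a₂ b hx, SFg_leaf_of_mem p hg hleaf hvx o a₁ a₂ γ hx,
        mW_leaf_of_mem p hg hleaf hvx a₁ a₂ hx]
      exact mul_div_leaf_aux _ _ _ _
    · rw [Ssig_eq_zero_of_notMem_self _ ends a₁ a₂ x b hx, zero_mul, zero_div, mul_zero,
        Ssig_eq_zero_of_mW_eq_zero hp ends a₁ a₂ v b W (mW_eq_zero_of_leaf p hg hleaf hvx a₁ a₂ hW hx),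
        zero_mul, zero_div]

omit [Fintype V] in
/-- The pointwise leaf split of `SFg` at a fixed centring `γ`. -/
lemma SFg_leaf_split {p : E → R} (hp : IsProbVec p) (hg : ends g = s(v, x))
    (hleaf : ∀ e, v ∈ ends e → e = g) (hvx : v ≠ x) (o a₁ a₂ : V) (γ : R) (W : Finset V) :
    RootEdge.SFg p ends o a₁ a₂ v γ W = (if W = {v} then RootEdge.SFg p ends o a₁ a₂ v γ {v} else 0) +
      p g * RootEdge.SFg (Function.update p g 1) ends o a₁ a₂ x γ W := by
  by_cases hW : W = {v}
  · subst hW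
    rw [if_pos rfl, SFg_singleton_eq_zero _ o a₁ a₂ hvx, mul_zero, add_zero]
  · rw [if_neg hW, zero_add]
    by_cases hx : x ∈ W
    · exact SFg_leaf_of_mem p hg hleaf hvx o a₁ a₂ γ hx
    · rw [SFg_eq_zero_of_notMem_self _ o a₁ a₂ hx, mul_zero]
      have hm := mW_eq_zero_of_leaf p hg hleaf hvx a₁ a₂ hW hx
      unfold RootEdge.SFg
      rw [Ssig_eq_zero_of_mW_eq_zero hp ends a₁ a₂ v o W hm, Su_eq_zero_of_mW_eq_zero hp ends a₁ a₂ v o W hm,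
        hm]
      ring

/-- The ratio sum at a fixed centring splits at the leaf. -/
lemma sum_termg_leaf {p : E → R} (hp : IsProbVec p) (hg : ends g = s(v, x))
    (hleaf : ∀ e, v ∈ ends e → e = g) (hvx : v ≠ x) (o a₁ a₂ b : V) (γ : R) :
    ∑ W : Finset V, Ssig p ends a₁ a₂ v b W * RootEdge.SFg p ends o a₁ a₂ v γ W / mW p ends a₁ a₂ v W =
      Ssig p ends a₁ a₂ v b {v} * RootEdge.SFg p ends o a₁ a₂ v γ {v} / mW p ends a₁ a₂ v {v} +
        p g * ∑ W : Finset V, Ssig (Function.update p g 1) ends a₁ a₂ x b W *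
          RootEdge.SFg (Function.update p g 1) ends o a₁ a₂ x γ W /
          mW (Function.update p g 1) ends a₁ a₂ x W := by
  rw [Finset.sum_congr rfl (fun W _ => termg_leaf_split hp hg hleaf hvx o a₁ a₂ b γ W),
    Finset.sum_add_distrib, Finset.sum_ite_eq', if_pos (Finset.mem_univ _), Finset.mul_sum]

/-- The `SFg`-sum at a fixed centring splits at the leaf. -/
lemma sum_SFg_leaf {p : E → R} (hp : IsProbVec p) (hg : ends g = s(v, x))
    (hleaf : ∀ e, v ∈ ends e → e = g) (hvx : v ≠ x) (o a₁ a₂ : V) (γ : R) :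
    ∑ W : Finset V, RootEdge.SFg p ends o a₁ a₂ v γ W =
      RootEdge.SFg p ends o a₁ a₂ v γ {v} +
        p g * ∑ W : Finset V, RootEdge.SFg (Function.update p g 1) ends o a₁ a₂ x γ W := by
  rw [Finset.sum_congr rfl (fun W _ => SFg_leaf_split hp hg hleaf hvx o a₁ a₂ γ W),
    Finset.sum_add_distrib, Finset.sum_ite_eq', if_pos (Finset.mem_univ _), Finset.mul_sum]

omit [Fintype V] [LinearOrder R] [IsStrictOrderedRing R] in
/-- `SFg(v, γ, {v}) = Ssig_o(v, {v})` (the world sign of `{v}` is `0`). -/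
lemma SFg_singleton_self (p : E → R) (o a₁ a₂ : V) (hv1 : v ≠ a₁) (hv2 : v ≠ a₂) (γ : R) :
    RootEdge.SFg p ends o a₁ a₂ v γ {v} = Ssig p ends a₁ a₂ v o {v} := by
  unfold RootEdge.SFg
  rw [s3_singleton (R := R) a₁ a₂ hv1 hv2]
  ring

/-- **(FM) is leaf-closed**: for `v` a leaf at `x` through `g` of weight `q`,
`FMfun p o a₁ a₂ v b = q · FMfun p[g ↦ 1] o a₁ a₂ x b` (`P(Q) ≠ 0`). -/
theorem FMfun_leaf {p : E → R} (hp : IsProbVec p) (hg : ends g = s(v, x))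
    (hleaf : ∀ e, v ∈ ends e → e = g) (hvx : v ≠ x) {o a₁ a₂ b : V} (hv1 : v ≠ a₁) (hv2 : v ≠ a₂)
    (ho : o ≠ v) (hb : b ≠ v) (hQ : prob p (avoidAll ends a₂ {a₁}) ≠ 0) :
    FMfun p ends o a₁ a₂ v b = p g * FMfun (Function.update p g 1) ends o a₁ a₂ x b := by
  have hQ1 : prob (Function.update p g 1) (avoidAll ends a₂ {a₁}) = prob p (avoidAll ends a₂ {a₁}) :=
    HMFPendantRoot.prob_update_one_of_free p (free_Q hg hleaf hvx hv1 hv2)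
  have hfree : ∀ y, y ≠ v → ∀ r, r ≠ v →
      prob (Function.update p g 1) (avoidAll ends a₂ {a₁} ∩ connEvent ends r y) =
        prob p (avoidAll ends a₂ {a₁} ∩ connEvent ends r y) := fun y hy r hr =>
    HMFPendantRoot.prob_update_one_of_free p
      ((free_Q hg hleaf hvx hv1 hv2).inter (free_connEvent hg hleaf hvx hr hy))
  have hmU : ∀ y, y ≠ v →
      LeafStep.mU (Function.update p g 1) ends a₁ a₂ y = LeafStep.mU p ends a₁ a₂ y := by
    intro y hy
    unfold LeafStep.mU
    rw [hfree y hy a₁ (Ne.symm hv1), hfree y hy a₂ (Ne.symm hv2)]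
  have hA : ∑ W : Finset V, Ssig (Function.update p g 1) ends a₁ a₂ x b W =
      prob p (avoidAll ends a₂ {a₁} ∩ connEvent ends a₁ b) -
        prob p (avoidAll ends a₂ {a₁} ∩ connEvent ends a₂ b) := by
    rw [← EQo_eq (Function.update p g 1) ends b a₁ a₂ x]
    unfold EQo
    rw [hfree b hb a₁ (Ne.symm hv1), hfree b hb a₂ (Ne.symm hv2)]
  have hD := prob_PD_leaf_free p hg hleaf hvx hv1 hv2
  rw [mW_singleton_leaf p hg hleaf hvx hv1 hv2] at hD
  unfold FMfun gamma0
  rw [hQ1, hmU o ho, hmU b hb, hD]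
  rw [sum_termg_leaf hp hg hleaf hvx o a₁ a₂ b, sum_Ssig_leaf hp hg hleaf hvx a₁ a₂ b,
    sum_SFg_leaf hp hg hleaf hvx o a₁ a₂, sum_termA_leaf hp hg hleaf hvx hv1 hv2 o b,
    sum_SuA_leaf hp hg hleaf hvx hv1 hv2 b, sum_SuA_leaf hp hg hleaf hvx hv1 hv2 o,
    SFg_singleton_self p o a₁ a₂ hv1 hv2, mW_singleton_leaf p hg hleaf hvx hv1 hv2,
    Ssig_singleton_leaf p hg hleaf hvx hv1 hv2 hb, Ssig_singleton_leaf p hg hleaf hvx hv1 hv2 ho,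
    Su_singleton_leaf p hg hleaf hvx hv1 hv2 hb, Su_singleton_leaf p hg hleaf hvx hv1 hv2 ho,
    div_leaf_aux, div_leaf_aux, hA]
  unfold LeafStep.mU
  field_simp
  ring

/-- **(FM) at a pendant vertex is (FM) at its attachment point** (`q > 0`, `P(Q) ≠ 0`). -/
theorem FM_leaf_iff {p : E → R} (hp : IsProbVec p) (hg : ends g = s(v, x))
    (hleaf : ∀ e, v ∈ ends e → e = g) (hvx : v ≠ x) {o a₁ a₂ b : V} (hv1 : v ≠ a₁) (hv2 : v ≠ a₂)
    (ho : o ≠ v) (hb : b ≠ v) (hQ : prob p (avoidAll ends a₂ {a₁}) ≠ 0) (hq : 0 < p g) :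
    FM p ends o a₁ a₂ v b ↔ FM (Function.update p g 1) ends o a₁ a₂ x b := by
  unfold FM
  rw [FMfun_leaf hp hg hleaf hvx hv1 hv2 ho hb hQ]
  exact mul_nonneg_iff_of_pos_left hq

end LeafClosed

end A3Fibre

end CovForm

end Summit.Ventures.PercRepro2
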